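import Literature.Computability.QuantumComplexity.GaussianCells
import HarnessLib

/-!
# Gaussian cell weights, II: the machine's rounded angles and the accuracy of the prepared state

Topic `Literature/Computability/QuantumComplexity`, sequel of `GaussianCells.lean` (cell weights
`w = cellW ℓ c`, prefix masses in closed form `prefG`) and `GroverRudolph.lean` (the perturbed-blocks
theorem `l2Norm_prod_genLevelGate_sub_qsample_le`). A machine preparing the one-dimensional Gaussian
state (Regev 2009, Lemma 3.12) does not rotate by the exact Grover–Rudolph angle
`cos θ = √(p(b0)/p(b))`: it computes the two prefix masses to `p` bits (`GaussIntegral.gaussFApprox`),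
forms the ratio, takes an integer square root, and hands the rotation gadget an integer `A ≤ 2ᵏ`
standing for `cos θ ≈ A/2ᵏ`; the gadget then realises the rotation with cosine EXACTLY `A/2ᵏ` (and sine
`√(1 − A²/4ᵏ)`) up to its own rounding. This file quantifies that this is good enough:

* `GaussianCells.rotC a` — the real rotation with cosine `a ∈ [0, 1]` (sine `√(1 − a²)`), unitary
  (`rotC_mem_unitaryGroup`); **`rotC_first_column_sub_le`**: if `|a − c| ≤ ε` for the exact unit pair `(c, s)`,
  `c, s ≥ 0`, its first column is within `(ε, √(2ε))` of `(c, s)` entrywise;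
* the numerical lemmas: `abs_sqrt_sub_sqrt_le` (`|√x − √y| ≤ √|x − y|`), **`abs_div_sub_div_le`** (ratios of
  `δ`-accurate masses over a floor `μ ≥ 4δ`: `|P̂₀/P̂ − P₀/P| ≤ 3δ/μ`), `abs_natSqrt_sub_sqrt_le`
  (`|⌊√m⌋ − √x| ≤ 1 + √|m − x|`);
* `GaussianCells.aOf k P̂ P̂₀` — THE MACHINE'S INTEGER: `min 2ᵏ ⌊√(round(4ᵏ · P̂₀/P̂))₊⌋` (an
  exact function of two rationals; `2ᵏ` when `P̂ ≤ 0`), and **`abs_aOf_div_sub_sqrt_le`**: on a prefix of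
  mass `P ≥ μ ≥ 4δ` with `δ`-accurate `P̂, P̂₀`, `|aOf/2ᵏ − √(P₀/P)| ≤ 2/2ᵏ + √(3δ/μ)`;
* the blocks `GaussianCells.machineBlock` (`rotC (aOf …/2ᵏ)` read off the prefix through any
  prefix-respecting table of approximate masses) satisfy the hypotheses `hRu`, `hRind` of the perturbed
  Grover–Rudolph theorem, with the *good* labels those of prefix mass `≥ μ` (`machineBlock_good`) and
  the bad mass bounded WITHOUT any tail estimate: **`badMass_le`**, `Σ_{bad} p/W ≤ 2^ℓ μ/W` (at most `2^ℓ`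
  prefixes, each of mass `< μ`; the machine takes `μ = W·2^{-(ℓ+2n)}` by computing to enough bits);
* **`GaussianCells.l2Norm_prod_machineBlock_sub_qsample_le`** — the conclusion: for every `δ`-accurate
  table and floor `μ ≥ 4δ`, the levels with the machine's blocks prepare, from a clean input, a state
  within `ℓ·√(2ε² + 8·2^ℓμ/W)` of the Gaussian qsample `qsample (cellW ℓ c)`, `ε = max(√(2ε₁), ε₁)`,
  `ε₁ = 2/2ᵏ + √(3δ/μ)`.

Everything here is proved; definitions have bodies; no named fact is introduced.

## References

* O. Regev, *On lattices, learning with errors, random linear codes, and cryptography*, J. ACM 56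
  (2009), art. 34, Lemma 3.12 (proof) and §2 p. 11 (finite precision) [Regev2009].
* L. Grover, T. Rudolph, arXiv:quant-ph/0208112 (2002), eq. (4) [GroverRudolph2002].
* M. A. Nielsen, I. L. Chuang, *Quantum Computation and Quantum Information*, Cambridge University Press 2010, §4.5.3 [NielsenChuang2010].
-/

noncomputable section

namespace Literature.Computability.QuantumComplexity

open _root_.Matrix Finset Cryptography Literature.Computability.Complexity Literature.Computability.Complexity.GaussIntegral GroverRudolph

namespace GaussianCells

/-! ### Numerical lemmas -/

/-- **`|√x − √y| ≤ √|x − y|`** for `x, y ≥ 0`. [folklore] -/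
theorem abs_sqrt_sub_sqrt_le {x y : ℝ} (hx : 0 ≤ x) (hy : 0 ≤ y) : |Real.sqrt x - Real.sqrt y| ≤ Real.sqrt |x - y| := by
  -- reduce to `x ≥ y`
  wlog hxy : y ≤ x generalizing x y
  · have h := this hy hx (le_of_lt (not_le.1 hxy))
    rwa [abs_sub_comm, abs_sub_comm y x] at h
  rw [abs_of_nonneg (sub_nonneg.2 (Real.sqrt_le_sqrt hxy)), abs_of_nonneg (sub_nonneg.2 hxy), sub_le_iff_le_add]
  have h1 : 0 ≤ Real.sqrt (x - y) := Real.sqrt_nonneg _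
  have h2 : 0 ≤ Real.sqrt y := Real.sqrt_nonneg _
  rw [Real.sqrt_le_left (by positivity)]
  nlinarith [Real.sq_sqrt (sub_nonneg.2 hxy), Real.sq_sqrt hy, mul_nonneg h1 h2]

/-- **Ratios of approximate masses**: for `0 ≤ P₀ ≤ P`, `μ ≤ P`, `|P̂ − P| ≤ δ`, `|P̂₀ − P₀| ≤ δ` and
`4δ ≤ μ`, the approximate ratio is `3δ/μ`-accurate: `|P̂₀/P̂ − P₀/P| ≤ 3δ/μ`. [cite: Regev2009, §2 (p. 11, finite precision)] -/
theorem abs_div_sub_div_le {P P₀ Ph Ph₀ δ μ : ℝ} (hP₀ : 0 ≤ P₀) (hP₀P : P₀ ≤ P) (hμ : μ ≤ P) (hμ0 : 0 < μ)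
    (hPh : |Ph - P| ≤ δ) (hPh₀ : |Ph₀ - P₀| ≤ δ) (hδ : 4 * δ ≤ μ) :
    |Ph₀ / Ph - P₀ / P| ≤ 3 * δ / μ := by
  have hδ0 : 0 ≤ δ := le_trans (abs_nonneg _) hPh
  have hP : 0 < P := lt_of_lt_of_le hμ0 hμ
  rw [abs_le] at hPh hPh₀
  have hPh34 : 3 * μ / 4 ≤ Ph := by linarith [hPh.1]
  have hPhpos : 0 < Ph := lt_of_lt_of_le (by linarith) hPh34
  rw [div_sub_div _ _ hPhpos.ne' hP.ne', abs_div, abs_of_pos (mul_pos hPhpos hP), div_le_div_iff₀ (mul_pos hPhpos hP) hμ0]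
  -- `|Ph₀ P − P₀ Ph| = |(Ph₀ − P₀) P + P₀ (P − Ph)| ≤ δ P + P δ = 2 δ P`
  have hnum : |Ph₀ * P - Ph * P₀| ≤ 2 * δ * P := by
    have : Ph₀ * P - Ph * P₀ = (Ph₀ - P₀) * P + P₀ * (P - Ph) := by ring
    rw [this]
    calc |(Ph₀ - P₀) * P + P₀ * (P - Ph)| ≤ |(Ph₀ - P₀) * P| + |P₀ * (P - Ph)| := abs_add_le _ _
      _ = |Ph₀ - P₀| * P + P₀ * |P - Ph| := by rw [abs_mul, abs_mul, abs_of_pos hP, abs_of_nonneg hP₀]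
      _ ≤ δ * P + P * δ := by
          gcongr
          · exact abs_le.2 hPh₀
          · rw [abs_sub_comm]; exact abs_le.2 hPh
      _ = 2 * δ * P := by ring
  calc |Ph₀ * P - Ph * P₀| * μ ≤ 2 * δ * P * μ := by gcongr
    _ ≤ 3 * δ * (Ph * P) := by nlinarith [mul_nonneg hδ0 hP.le]

/-- `|⌊√m⌋ − √x| ≤ 1 + √|m − x|` for a natural `m` and a real `x ≥ 0`. [folklore] -/
theorem abs_natSqrt_sub_sqrt_le (m : ℕ) {x : ℝ} (hx : 0 ≤ x) : |(Nat.sqrt m : ℝ) - Real.sqrt x| ≤ 1 + Real.sqrt |(m : ℝ) - x| := by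
  have h1 : |(Nat.sqrt m : ℝ) - Real.sqrt m| ≤ 1 := by
    rw [abs_le]
    constructor
    · linarith [Real.real_sqrt_lt_nat_sqrt_succ (a := m)]
    · linarith [Real.nat_sqrt_le_real_sqrt (a := m)]
  have h2 := abs_sqrt_sub_sqrt_le (Nat.cast_nonneg m) hx
  calc |(Nat.sqrt m : ℝ) - Real.sqrt x| = |((Nat.sqrt m : ℝ) - Real.sqrt m) + (Real.sqrt m - Real.sqrt x)| := by ring_nf
    _ ≤ |(Nat.sqrt m : ℝ) - Real.sqrt m| + |Real.sqrt m - Real.sqrt x| := abs_add_le _ _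
    _ ≤ 1 + Real.sqrt |(m : ℝ) - x| := add_le_add h1 h2

/-! ### The machine's integer and its accuracy -/

/-- **The machine's integer** standing for `2ᵏ cos θ`: `min 2ᵏ ⌊√(round(4ᵏ · P̂₀/P̂))₊⌋`
(`2ᵏ` when `P̂ ≤ 0`, a massless or ill-approximated prefix: the block is then the identity-like rotation;
a negative rounded value counts as `0`). [cite: Regev2009, Lemma 3.12 (proof) with §2 p. 11] -/
def aOf (k : ℕ) (Ph Ph₀ : ℚ) : ℕ :=
  if Ph ≤ 0 then 2 ^ k else min (2 ^ k) (Nat.sqrt (round ((4 : ℚ) ^ k * (Ph₀ / Ph))).toNat)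

/-- `aOf ≤ 2ᵏ`. [folklore] -/
theorem aOf_le (k : ℕ) (Ph Ph₀ : ℚ) : aOf k Ph Ph₀ ≤ 2 ^ k := by
  unfold aOf; split_ifs
  · exact le_rfl
  · exact min_le_left _ _

/-- **Accuracy of the machine's integer** on a prefix of mass `P ≥ μ ≥ 4δ` with `δ`-accurate rational
approximations `P̂, P̂₀` of `P, P₀` (`0 ≤ P₀ ≤ P`): `|aOf/2ᵏ − √(P₀/P)| ≤ 2/2ᵏ + √(3δ/μ)`.
[cite: Regev2009, §2 (p. 11, finite precision)] -/
theorem abs_aOf_div_sub_sqrt_le (k : ℕ) {P P₀ δ μ : ℝ} {Ph Ph₀ : ℚ} (hP₀ : 0 ≤ P₀) (hP₀P : P₀ ≤ P) (hμ : μ ≤ P)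
    (hμ0 : 0 < μ) (hPh : |(Ph : ℝ) - P| ≤ δ) (hPh₀ : |(Ph₀ : ℝ) - P₀| ≤ δ) (hδ : 4 * δ ≤ μ) :
    |(aOf k Ph Ph₀ : ℝ) / 2 ^ k - Real.sqrt (P₀ / P)| ≤ 2 / 2 ^ k + Real.sqrt (3 * δ / μ) := by
  have hP : 0 < P := lt_of_lt_of_le hμ0 hμ
  have hδ0 : 0 ≤ δ := le_trans (abs_nonneg _) hPh
  have hPhpos : (0 : ℝ) < Ph := by rw [abs_le] at hPh; linarith [hPh.1]
  have hPhposQ : (0 : ℚ) < Ph := by exact_mod_cast hPhpos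
  have h2k : (0 : ℝ) < 2 ^ k := by positivity
  -- the ratio
  set r : ℝ := P₀ / P with hr
  have hr0 : 0 ≤ r := div_nonneg hP₀ hP.le
  have hr1 : r ≤ 1 := (div_le_one hP).2 hP₀P
  set q : ℚ := Ph₀ / Ph with hq
  have hcl : |(q : ℝ) - r| ≤ 3 * δ / μ := by
    rw [hq]; push_cast; exact abs_div_sub_div_le hP₀ hP₀P hμ hμ0 hPh hPh₀ hδ
  have hδμ : 0 ≤ 3 * δ / μ := by positivity
  -- unfold the machine's integer
  set m : ℤ := round ((4 : ℚ) ^ k * q) with hm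
  have haOf : aOf k Ph Ph₀ = min (2 ^ k) (Nat.sqrt m.toNat) := by
    unfold aOf; rw [if_neg (not_le.2 hPhposQ)]
  rw [haOf]
  have hroundQ : |(4 : ℝ) ^ k * (q : ℝ) - (m : ℝ)| ≤ 1 / 2 := by
    have := abs_sub_round ((4 : ℚ) ^ k * q)
    rw [← hm] at this
    have h' := (Rat.cast_le (K := ℝ)).2 this
    push_cast at h'
    exact h'
  -- `2^k √r = √(4^k r)` and `√(a + b) ≤ √a + √b`
  have h4 : (4 : ℝ) ^ k = (2 ^ k) ^ 2 := by rw [← pow_mul, mul_comm, pow_mul]; norm_num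
  have hsqrt_add : ∀ a b : ℝ, 0 ≤ a → 0 ≤ b → Real.sqrt (a + b) ≤ Real.sqrt a + Real.sqrt b := by
    intro a b ha hb
    rw [Real.sqrt_le_left (by positivity)]
    nlinarith [Real.sq_sqrt ha, Real.sq_sqrt hb, mul_nonneg (Real.sqrt_nonneg a) (Real.sqrt_nonneg b)]
  have hsq4 : Real.sqrt ((4 : ℝ) ^ k * (3 * δ / μ)) = 2 ^ k * Real.sqrt (3 * δ / μ) := by
    rw [h4, Real.sqrt_mul (by positivity), Real.sqrt_sq h2k.le]
  -- the main estimate on `|⌊√M⌋ − 2^k √r|`, `M = m₊`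
  have hstep : |(Nat.sqrt m.toNat : ℝ) - (2 : ℝ) ^ k * Real.sqrt r| ≤ 2 + (2 : ℝ) ^ k * Real.sqrt (3 * δ / μ) := by
    rcases le_or_gt 0 m with hm0 | hm0
    · -- `m ≥ 0`: `M = m` is within `1/2 + 4^k·3δ/μ` of `4^k r`
      have hMm : ((m.toNat : ℕ) : ℝ) = (m : ℝ) := by exact_mod_cast Int.toNat_of_nonneg hm0
      have hsq : (2 : ℝ) ^ k * Real.sqrt r = Real.sqrt ((4 : ℝ) ^ k * r) := by
        rw [h4, Real.sqrt_mul (by positivity), Real.sqrt_sq h2k.le]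
      rw [hsq]
      refine (abs_natSqrt_sub_sqrt_le m.toNat (by positivity)).trans ?_
      have hin : |((m.toNat : ℕ) : ℝ) - (4 : ℝ) ^ k * r| ≤ 1 / 2 + (4 : ℝ) ^ k * (3 * δ / μ) := by
        rw [hMm]
        calc |(m : ℝ) - (4 : ℝ) ^ k * r|
            = |((m : ℝ) - (4 : ℝ) ^ k * (q : ℝ)) + (4 : ℝ) ^ k * ((q : ℝ) - r)| := by ring_nf
          _ ≤ |(m : ℝ) - (4 : ℝ) ^ k * (q : ℝ)| + |(4 : ℝ) ^ k * ((q : ℝ) - r)| := abs_add_le _ _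
          _ ≤ 1 / 2 + (4 : ℝ) ^ k * (3 * δ / μ) :=
              add_le_add (by rw [abs_sub_comm]; exact hroundQ) (by
                rw [abs_mul, abs_of_pos (by positivity : (0 : ℝ) < 4 ^ k)]
                exact mul_le_mul_of_nonneg_left hcl (by positivity))
      calc 1 + Real.sqrt |((m.toNat : ℕ) : ℝ) - (4 : ℝ) ^ k * r|
          ≤ 1 + Real.sqrt (1 / 2 + (4 : ℝ) ^ k * (3 * δ / μ)) := by gcongr
        _ ≤ 1 + (Real.sqrt (1 / 2) + Real.sqrt ((4 : ℝ) ^ k * (3 * δ / μ))) := by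
            gcongr; exact hsqrt_add _ _ (by norm_num) (by positivity)
        _ ≤ 1 + (1 + (2 : ℝ) ^ k * Real.sqrt (3 * δ / μ)) := by
            rw [hsq4]
            gcongr
            rw [Real.sqrt_le_left zero_le_one]; norm_num
        _ = 2 + (2 : ℝ) ^ k * Real.sqrt (3 * δ / μ) := by ring
    · -- `m < 0`: `M = 0`, and `4^k q < 1/2`, so `2^k √r ≤ 1 + 2^k √(3δ/μ)`
      have hM0 : m.toNat = 0 := Int.toNat_eq_zero.2 hm0.le
      rw [hM0, Nat.sqrt_zero, Nat.cast_zero, zero_sub, abs_neg, abs_of_nonneg (by positivity)]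
      have hmR : (m : ℝ) ≤ -1 := by exact_mod_cast Int.le_sub_one_iff.2 hm0
      have hq' : (4 : ℝ) ^ k * (q : ℝ) ≤ 1 / 2 := by rw [abs_le] at hroundQ; linarith [hroundQ.2]
      have hr' : (4 : ℝ) ^ k * r ≤ 1 / 2 + (4 : ℝ) ^ k * (3 * δ / μ) := by
        have : (4 : ℝ) ^ k * r = (4 : ℝ) ^ k * (q : ℝ) + (4 : ℝ) ^ k * (r - (q : ℝ)) := by ring
        rw [this, abs_sub_comm] at *
        have h2 : (4 : ℝ) ^ k * (r - (q : ℝ)) ≤ (4 : ℝ) ^ k * (3 * δ / μ) :=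
          mul_le_mul_of_nonneg_left ((le_abs_self _).trans hcl) (by positivity)
        linarith
      have hsq : (2 : ℝ) ^ k * Real.sqrt r = Real.sqrt ((4 : ℝ) ^ k * r) := by
        rw [h4, Real.sqrt_mul (by positivity), Real.sqrt_sq h2k.le]
      rw [hsq]
      calc Real.sqrt ((4 : ℝ) ^ k * r) ≤ Real.sqrt (1 / 2 + (4 : ℝ) ^ k * (3 * δ / μ)) := Real.sqrt_le_sqrt hr'
        _ ≤ Real.sqrt (1 / 2) + Real.sqrt ((4 : ℝ) ^ k * (3 * δ / μ)) := hsqrt_add _ _ (by norm_num) (by positivity)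
        _ ≤ 1 + (2 : ℝ) ^ k * Real.sqrt (3 * δ / μ) := by
            rw [hsq4]; gcongr; rw [Real.sqrt_le_left zero_le_one]; norm_num
        _ ≤ 2 + (2 : ℝ) ^ k * Real.sqrt (3 * δ / μ) := by linarith
  -- Step 2: clamping at `2^k` does not hurt since `2^k √r ≤ 2^k`
  have htarget : (2 : ℝ) ^ k * Real.sqrt r ≤ 2 ^ k := by
    have : Real.sqrt r ≤ 1 := Real.sqrt_le_one.2 hr1
    calc (2 : ℝ) ^ k * Real.sqrt r ≤ 2 ^ k * 1 := by gcongr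
      _ = 2 ^ k := mul_one _
  have hclamp : |((min (2 ^ k) (Nat.sqrt m.toNat) : ℕ) : ℝ) - (2 : ℝ) ^ k * Real.sqrt r| ≤
      |(Nat.sqrt m.toNat : ℝ) - (2 : ℝ) ^ k * Real.sqrt r| := by
    rcases le_total (2 ^ k) (Nat.sqrt m.toNat) with h | h
    · rw [min_eq_left h]
      have hcast : ((2 ^ k : ℕ) : ℝ) ≤ (Nat.sqrt m.toNat : ℝ) := by exact_mod_cast h
      push_cast at hcast ⊢
      rw [abs_of_nonneg (by linarith), abs_of_nonneg (by linarith)]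
      linarith
    · rw [min_eq_right h]
  -- combine and divide by `2^k`
  have hmain : |((min (2 ^ k) (Nat.sqrt m.toNat) : ℕ) : ℝ) - (2 : ℝ) ^ k * Real.sqrt r| ≤ 2 + (2 : ℝ) ^ k * Real.sqrt (3 * δ / μ) :=
    hclamp.trans hstep
  have hdiv : |((min (2 ^ k) (Nat.sqrt m.toNat) : ℕ) : ℝ) / 2 ^ k - Real.sqrt r| =
      |((min (2 ^ k) (Nat.sqrt m.toNat) : ℕ) : ℝ) - (2 : ℝ) ^ k * Real.sqrt r| / 2 ^ k := by
    rw [← abs_of_pos h2k, ← abs_div, abs_of_pos h2k]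
    congr 1
    field_simp
  rw [hdiv, div_le_iff₀ h2k]
  calc |((min (2 ^ k) (Nat.sqrt m.toNat) : ℕ) : ℝ) - (2 : ℝ) ^ k * Real.sqrt r| ≤ 2 + (2 : ℝ) ^ k * Real.sqrt (3 * δ / μ) := hmain
    _ = (2 / 2 ^ k + Real.sqrt (3 * δ / μ)) * 2 ^ k := by field_simp

/-! ### The rotation with a prescribed cosine -/

/-- **The real rotation with cosine `a`** (sine `√(1 − a²)`), as a one-qubit block (rows = output bit,
columns = input bit). [cite: GroverRudolph2002, eq. (4)] -/
def rotC (a : ℝ) : Matrix (QReg 1) (QReg 1) ℂ :=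
  Matrix.of fun x z : QReg 1 =>
    if z 0 = false then (if x 0 = false then (a : ℂ) else (Real.sqrt (1 - a ^ 2) : ℂ))
    else (if x 0 = false then -(Real.sqrt (1 - a ^ 2) : ℂ) else (a : ℂ))

/-- **`rotC a` is unitary** for `|a| ≤ 1`. [folklore] -/
theorem rotC_mem_unitaryGroup {a : ℝ} (ha0 : 0 ≤ a) (ha1 : a ≤ 1) : rotC a ∈ Matrix.unitaryGroup (QReg 1) ℂ := by
  have hs : a ^ 2 + Real.sqrt (1 - a ^ 2) ^ 2 = 1 := by
    rw [Real.sq_sqrt (by nlinarith)]; ring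
  unfold rotC
  rw [Matrix.mem_unitaryGroup_iff]
  ext x z
  simp only [Matrix.mul_apply, Matrix.star_apply, Matrix.of_apply, Matrix.one_apply, RCLike.star_def]
  rw [Fintype.sum_eq_add (fun _ => false) (fun _ => true) (by intro e; have := congrFun e 0; simp at this)
    (by intro w hw; exfalso
        cases hw0 : w 0
        · exact hw.1 (qreg_one_ext hw0)
        · exact hw.2 (qreg_one_ext hw0))]
  have keyC : (a : ℂ) * a + (Real.sqrt (1 - a ^ 2) : ℂ) * Real.sqrt (1 - a ^ 2) = 1 := by
    have := congrArg (fun r : ℝ => (r : ℂ)) hs; push_cast at this; linear_combination this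
  by_cases hxz : x = z
  · subst hxz
    rw [if_pos rfl]
    cases hx : x 0 <;> simp [Complex.conj_ofReal] <;> linear_combination keyC
  · rw [if_neg hxz]
    have hne : x 0 ≠ z 0 := fun e => hxz (qreg_one_ext e)
    cases hx : x 0 <;> cases hz : z 0 <;> simp_all [Complex.conj_ofReal] <;> ring

/-- **First-column accuracy of `rotC`**: if `|a − c| ≤ ε` for a unit pair `(c, s)` with `c, s ≥ 0` and
`0 ≤ a ≤ 1`, then `|a − c| ≤ ε` and `|√(1−a²) − s| ≤ √(2ε)`. [cite: NielsenChuang2010, §4.5.3] -/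
theorem rotC_first_column_sub_le {a c s ε : ℝ} (ha0 : 0 ≤ a) (ha1 : a ≤ 1) (hc0 : 0 ≤ c) (hs0 : 0 ≤ s)
    (hcs : c ^ 2 + s ^ 2 = 1) (hac : |a - c| ≤ ε) :
    ‖rotC a (fun _ => false) (fun _ => false) - (c : ℂ)‖ ≤ ε ∧
      ‖rotC a (fun _ => true) (fun _ => false) - (s : ℂ)‖ ≤ Real.sqrt (2 * ε) := by
  have hc1 : c ≤ 1 := by nlinarith
  constructor
  · unfold rotC
    simp only [Matrix.of_apply, ↓reduceIte]
    rw [← Complex.ofReal_sub, Complex.norm_real, Real.norm_eq_abs]; exact hac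
  · unfold rotC
    simp only [Matrix.of_apply, ↓reduceIte, Bool.true_eq_false]
    rw [← Complex.ofReal_sub, Complex.norm_real, Real.norm_eq_abs]
    have hs : s = Real.sqrt (1 - c ^ 2) := by
      rw [← Real.sqrt_sq hs0]; congr 1; linarith
    rw [hs]
    refine (abs_sqrt_sub_sqrt_le (by nlinarith) (by nlinarith)).trans ?_
    apply Real.sqrt_le_sqrt
    rw [show (1 - a ^ 2) - (1 - c ^ 2) = (c - a) * (c + a) by ring, abs_mul]
    calc |c - a| * |c + a| ≤ ε * 2 := by
          gcongr
          · exact le_trans (abs_nonneg _) hac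
          · rw [abs_sub_comm]; exact hac
          · rw [abs_of_nonneg (by linarith)]; linarith
      _ = 2 * ε := by ring

/-! ### The machine's blocks and the hypotheses of the perturbed Grover–Rudolph theorem -/

section Blocks

variable {ℓ : ℕ} (c : ℝ) (k : ℕ)

/-- A table of approximate prefix masses: to a level `j ≤ ℓ` and a prefix value `q = hiVal j y` it
assigns a rational approximation of `prefG ℓ c j y` (what the machine computes with `gaussFApprox`; this
file is agnostic about how). [cite: Regev2009, Lemma 3.12 (proof)] -/
abbrev MassTable : Type := ℕ → ℕ → ℚ

variable (T : MassTable)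

/-- **The machine's cosine numerator at level `j` for the prefix of `y`**: `aOf k P̂ P̂₀` with
`P̂ = T j (hiVal j y)`, `P̂₀ = T (j+1) (2·hiVal j y)` (the prefix extended by the bit `0`, `hiVal_succ`).
[cite: Regev2009, Lemma 3.12 (proof)] -/
def machineA (j : ℕ) (y : Fin ℓ → Bool) : ℕ := aOf k (T j (hiVal j y)) (T (j + 1) (2 * hiVal j y))

/-- **The machine's block**: the rotation with cosine `machineA/2ᵏ`. [cite: GroverRudolph2002, eq. (4)] -/
def machineBlock (j : Fin ℓ) (y : Fin ℓ → Bool) : Matrix (QReg 1) (QReg 1) ℂ := rotC ((machineA k T j y : ℝ) / 2 ^ k)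

/-- The cosine handed to the gadget lies in `[0, 1]`. [folklore] -/
theorem machineA_div_mem (j : ℕ) (y : Fin ℓ → Bool) :
    0 ≤ (machineA k T j y : ℝ) / 2 ^ k ∧ (machineA k T j y : ℝ) / 2 ^ k ≤ 1 := by
  refine ⟨by positivity, ?_⟩
  rw [div_le_one (by positivity)]
  exact_mod_cast aOf_le k _ _

/-- **The machine's blocks are unitary** (hypothesis `hRu`). [folklore] -/
theorem machineBlock_mem_unitaryGroup (j : Fin ℓ) (y : Fin ℓ → Bool) : machineBlock k T j y ∈ Matrix.unitaryGroup (QReg 1) ℂ := by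
  obtain ⟨h0, h1⟩ := machineA_div_mem k T j y
  exact rotC_mem_unitaryGroup h0 h1

/-- **The machine's blocks do not read the bits from `j` on** (hypothesis `hRind`). [folklore] -/
theorem machineBlock_update (j : Fin ℓ) (y : Fin ℓ → Bool) (b : Bool) : machineBlock k T j (Function.update y j b) = machineBlock k T j y := by
  unfold machineBlock machineA
  rw [hiVal_update j le_rfl]

/-- **Good prefixes** at level `j`: prefix mass at least `μ`. [cite: Regev2009, Lemma 3.12 (proof)] -/
def Good (μ : ℝ) (j : Fin ℓ) (y : Fin ℓ → Bool) : Prop := μ ≤ prefG ℓ c j y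

/-- Goodness is decidable (classically). [folklore] -/
instance (μ : ℝ) (j : Fin ℓ) (y : Fin ℓ → Bool) : Decidable (Good c μ j y) := Classical.propDecidable _

/-- A table is `δ`-**accurate** when each entry is within `δ` of the closed-form prefix mass it stands for.
[cite: Regev2009, §2 (p. 11)] -/
def Accurate (δ : ℝ) : Prop := ∀ (j : ℕ) (y : Fin ℓ → Bool), j ≤ ℓ → |(T j (hiVal j y) : ℝ) - prefG ℓ c j y| ≤ δ

/-- **On good prefixes the machine's block is entrywise close to the exact rotation** (hypothesis
`hgood` of `l2Norm_prod_genLevelGate_sub_qsample_le`, with `ε = √(2ε₁) ⊔ ε₁`, `ε₁ = 2/2ᵏ + √(3δ/μ)`).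
[cite: Regev2009, Lemma 3.12 (proof) with §2 p. 11] [cite: GroverRudolph2002, eq. (4)] -/
theorem machineBlock_good {δ μ : ℝ} (hμ0 : 0 < μ) (hδ : 4 * δ ≤ μ) (hT : Accurate (ℓ := ℓ) c T δ)
    (j : Fin ℓ) (y : Fin ℓ → Bool) (hy : Good c μ j y) :
    ‖machineBlock k T j y (fun _ => false) (fun _ => false) - rotBlock (cellW ℓ c) j y (fun _ => false) (fun _ => false)‖ ≤
        max (Real.sqrt (2 * (2 / 2 ^ k + Real.sqrt (3 * δ / μ)))) (2 / 2 ^ k + Real.sqrt (3 * δ / μ)) ∧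
      ‖machineBlock k T j y (fun _ => true) (fun _ => false) - rotBlock (cellW ℓ c) j y (fun _ => true) (fun _ => false)‖ ≤
        max (Real.sqrt (2 * (2 / 2 ^ k + Real.sqrt (3 * δ / μ)))) (2 / 2 ^ k + Real.sqrt (3 * δ / μ)) := by
  have hw : ∀ y, 0 ≤ cellW ℓ c y := cellW_nonneg ℓ c
  have hj : (j : ℕ) ≤ ℓ := Nat.le_of_lt j.2
  have hj1 : (j : ℕ) + 1 ≤ ℓ := j.2
  -- the exact masses
  set P : ℝ := prefW (cellW ℓ c) j y with hP
  set P₀ : ℝ := prefW (cellW ℓ c) (j + 1) (Function.update y j false) with hP₀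
  have hPG : P = prefG ℓ c j y := prefW_cellW_of_le ℓ c hj y
  have hP₀G : P₀ = prefG ℓ c (j + 1) (Function.update y j false) := prefW_cellW_of_le ℓ c hj1 _
  have hμP : μ ≤ P := by rw [hPG]; exact hy
  have hPpos : 0 < P := lt_of_lt_of_le hμ0 hμP
  have hP₀0 : 0 ≤ P₀ := prefW_nonneg _ hw _ _
  have hP₀P : P₀ ≤ P := prefW_update_le _ hw j y false
  -- the table entries
  have hT1 : |(T j (hiVal j y) : ℝ) - P| ≤ δ := by rw [hPG]; exact hT j y hj
  have hT0 : |(T ((j : ℕ) + 1) (2 * hiVal j y) : ℝ) - P₀| ≤ δ := by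
    have h := hT (j + 1) (Function.update y j false) hj1
    have hv : hiVal ((j : ℕ) + 1) (Function.update y j false) = 2 * hiVal j y := by
      have := hiVal_succ j (Function.update y j false)
      rw [Function.update_self] at this
      simp only [Bool.false_eq_true, ↓reduceIte, add_zero] at this
      rw [this, hiVal_update j le_rfl]
    rw [hv] at h; rw [hP₀G]; exact h
  -- accuracy of the cosine
  have hacc := abs_aOf_div_sub_sqrt_le k hP₀0 hP₀P hμP hμ0 hT1 hT0 hδ
  -- the exact rotation entries
  have hrot : rotBlock (cellW ℓ c) j y = Matrix.of fun a b : QReg 1 =>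
      if b 0 = false then (if a 0 = false then (cosGR (cellW ℓ c) j y : ℂ) else (sinGR (cellW ℓ c) j y : ℂ))
      else (if a 0 = false then -(sinGR (cellW ℓ c) j y : ℂ) else (cosGR (cellW ℓ c) j y : ℂ)) := by
    unfold rotBlock; rw [if_neg hPpos.ne']
  have hcos : cosGR (cellW ℓ c) j y = Real.sqrt (P₀ / P) := rfl
  have hunit := cosGR_sq_add_sinGR_sq (cellW ℓ c) hw j y hPpos
  obtain ⟨ha0, ha1⟩ := machineA_div_mem k T j y
  have hcol := rotC_first_column_sub_le (ε := 2 / 2 ^ k + Real.sqrt (3 * δ / μ)) (c := cosGR (cellW ℓ c) j y)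
    (s := sinGR (cellW ℓ c) j y) ha0 ha1 (Real.sqrt_nonneg _) (Real.sqrt_nonneg _) hunit (by rw [hcos]; exact hacc)
  unfold machineBlock
  rw [hrot]
  simp only [Matrix.of_apply, ↓reduceIte, Bool.true_eq_false]
  unfold machineA
  exact ⟨hcol.1.trans (le_max_right _ _), hcol.2.trans (le_max_left _ _)⟩

/-- **The bad mass without tail estimates**: the clean level-`j` labels that are not good carry normalised
mass `≤ 2^ℓ μ/W` (there are at most `2^ℓ` of them, each of mass `< μ`). [cite: Regev2009, Lemma 3.12 (proof)] -/
theorem badMass_le {μ : ℝ} (hμ0 : 0 ≤ μ) (j : Fin ℓ) :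
    ∑ y ∈ (cleanFrom (ℓ := ℓ) j).filter (fun y => ¬ Good c μ j y), prefW (cellW ℓ c) j y / total (cellW ℓ c) ≤
      2 ^ ℓ * μ / total (cellW ℓ c) := by
  have hw : ∀ y, 0 ≤ cellW ℓ c y := cellW_nonneg ℓ c
  haveI : Nonempty (Fin ℓ → Bool) := ⟨fun _ => false⟩
  have hW : 0 < total (cellW ℓ c) := total_cellW_pos ℓ c
  have hj : (j : ℕ) ≤ ℓ := Nat.le_of_lt j.2
  calc ∑ y ∈ (cleanFrom (ℓ := ℓ) j).filter (fun y => ¬ Good c μ j y), prefW (cellW ℓ c) j y / total (cellW ℓ c)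
      ≤ ∑ y ∈ (cleanFrom (ℓ := ℓ) j).filter (fun y => ¬ Good c μ j y), μ / total (cellW ℓ c) := by
        refine sum_le_sum fun y hy => ?_
        rw [mem_filter] at hy
        have hlt : prefG ℓ c j y < μ := not_le.1 hy.2
        rw [← prefW_cellW_of_le ℓ c hj y] at hlt
        exact div_le_div_of_nonneg_right hlt.le hW.le
    _ = ((cleanFrom (ℓ := ℓ) j).filter (fun y => ¬ Good c μ j y)).card * (μ / total (cellW ℓ c)) := by rw [sum_const, nsmul_eq_mul]
    _ ≤ (2 ^ ℓ : ℕ) * (μ / total (cellW ℓ c)) := by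
        have hcard : ((cleanFrom (ℓ := ℓ) j).filter (fun y => ¬ Good c μ j y)).card ≤ 2 ^ ℓ :=
          (card_le_univ _).trans (by rw [Fintype.card_fun, Fintype.card_bool, Fintype.card_fin])
        have hcardR : ((((cleanFrom (ℓ := ℓ) j).filter (fun y => ¬ Good c μ j y)).card : ℕ) : ℝ) ≤ ((2 ^ ℓ : ℕ) : ℝ) := by
          exact_mod_cast hcard
        exact mul_le_mul_of_nonneg_right hcardR (div_nonneg hμ0 hW.le)
    _ = 2 ^ ℓ * μ / total (cellW ℓ c) := by push_cast; ring

/-- **The prepared state is close to the Gaussian qsample** (the perturbed Grover–Rudolph theorem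
instantiated with the machine's blocks): on a clean input, the product of the levels with blocks
`machineBlock k T` is within `ℓ · √(2ε² + 8·2^ℓ μ/W)` of `qsample (cellW ℓ c)`, where
`ε = max(√(2ε₁), ε₁)`, `ε₁ = 2/2ᵏ + √(3δ/μ)`, for every `δ`-accurate table `T` and floor `μ ≥ 4δ`.
[cite: Regev2009, Lemma 3.12 (proof)] [cite: GroverRudolph2002, eqs. (1)–(5)] -/
theorem l2Norm_prod_machineBlock_sub_qsample_le {N : ℕ} (ws : Fin ℓ ↪ Fin N) {δ μ : ℝ} (hμ0 : 0 < μ) (hδ : 4 * δ ≤ μ)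
    (hT : Accurate (ℓ := ℓ) c T δ) (x : QReg N) (hx : ∀ i, x (ws i) = false) :
    l2Norm ((List.ofFn fun j => genLevelGate ws (machineBlock k T) j).reverse.prod *ᵥ basisState x - qsample (cellW ℓ c) ws x) ≤
      ℓ * Real.sqrt (2 * (max (Real.sqrt (2 * (2 / 2 ^ k + Real.sqrt (3 * δ / μ)))) (2 / 2 ^ k + Real.sqrt (3 * δ / μ))) ^ 2 +
        8 * (2 ^ ℓ * μ / total (cellW ℓ c))) := by
  haveI : Nonempty (Fin ℓ → Bool) := ⟨fun _ => false⟩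
  exact l2Norm_prod_genLevelGate_sub_qsample_le (cellW ℓ c) ws (cellW_nonneg ℓ c) (total_cellW_pos ℓ c)
    (machineBlock k T) (machineBlock_mem_unitaryGroup k T) (machineBlock_update k T) (Good c μ)
    (machineBlock_good c k T hμ0 hδ hT) (badMass_le c hμ0.le) x hx

end Blocks

end GaussianCells

end Literature.Computability.QuantumComplexity

end
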